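import Mathlib
import Literature.Computability.Cryptography.QubitRegister
import Literature.Computability.QuantumComplexity.PauliExpansion
import HarnessLib

/-!
# Barrier catalogue `QuantumAdvantage` — the almost-bent witness: the data-loading state of `x ↦ x³` on `𝔽_{2ⁿ}` is `2^{1−n/2}`-flat

Topic `Literature/Barriers/QuantumAdvantage` (D-0021). Summit statement:
`QuantumAdvantage := ∃ L, L ∈ BQP ∧ L ∉ BPP`.

One of six entries that file the PROVED bounds of the retired route `SymplecticPurity`
(`Summits/QuantumAdvantage/QuantumAdvantage/Theses/SymplecticPurity.lean`, closed `retired` on the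
human ruling of 2026-08-16) as barrier items: `NoFreeFramePurityBound` (`symplecticPurityBound`),
`NoFreeFrameGaussianBound` (`gaussianDegreeBound`), `NoFreeFrameSBoxSpectrum` (`graphStateSpectrum`),
`NoFreeFrameCubeAlmostBent` (`cubeAlmostBent`), `NoFreeFrameCubeGraphFlat` (this file, fact
`cubeGraphFlat` — the EXPLICIT flat family), `NoFreeFrame` (`noFreeFrame`). The six files are
independent (no mutual imports).

BARRIER: technique_class := any classical-simulation line for Clifford+T families that needs the
  intermediate states of EXPLICIT, uniformly generated, arithmetically simple computations to have a
  peaked or compressible Pauli spectrum — free Clifford frames (`symplecticPurityBound`), free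
  matchgate frames (`gaussianDegreeBound`), Pauli truncation, low stabilizer Rényi entropy — as
  opposed to statements about random or worst-case states;
  blocks := the unnormalised graph vector `g = Σ_x |x⟩|x³⟩` of the cube map of a field with `2ⁿ`
  elements (coordinates through ANY additive identification `e : K ≃+ 𝔽₂ⁿ`), on `n + n` qubits,
  has `|⟨g|σ_S|g⟩| ≤ 2·√2ⁿ` for every Pauli string `S ≠ I` (`cubeGraphFlat`); since `‖g‖² = 2ⁿ`
  the normalised data-loading state is `ε`-flat with `ε = 2^{1−n/2}` — so by `symplecticPurityBound`
  every Clifford frame, with any stabilizer ancillas and in any qubit order, has a bond of Schmidt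
  rank `≥ 2^{n/2−3}`, by `gaussianDegreeBound` no matchgate frame compresses its initial blocks, its
  stabilizer 2-Rényi entropy is `≥ n − 3` (linear, not `o(n)`), and a uniform Clifford+T family
  reaching it refutes the free-frame road to `BQP ⊆ BPP` (`noFreeFrame`); the state is prepared from `|+⟩^{⊗n}|0ⁿ⟩`
  by `O(n²)` Toffoli/CNOT gates (a quadratic map over `𝔽₂`), i.e. it is cheap and explicit;
  because := the S-box dictionary (`graphStateSpectrum`: `|⟨g_f|σ_S|g_f⟩| ≤ max(D, Λ)`) applied to
  `f = ` cube, which is almost perfect nonlinear (`D = 2`) and near-bent (`Λ ≤ 2·√2ⁿ`)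
  [cite: Carlet2020, §11.5.2 (PDF p. 497) and PDF pp. 222–223] [cite: Gold1968] [cite: Nyberg1994]
  (`cubeAlmostBent`); additivity of `e` suffices because additive = `𝔽₂`-linear, so differential
  counts and Walsh sums transport through `e` [folklore]; machine-checked in this tree (see `status`),
  and checked numerically at planning for `n = 3..7` (`D = 2`, `Λ = 4, 8, 8, 16, 16` — the bound is
  attained for even `n`);
  evasions_known := none for THIS family (unconditional); the barrier is evaded only by technique
  classes insensitive to Pauli flatness (non-free frames, composite Clifford∘Gaussian∘Clifford frames
  — undecided ex-crux `CompositeFrameBound`, stmt-QuantumAdvantage-10730 — stabilizer-rank or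
  quasi-probability simulators with their own accounting) or by arguing about algorithmically
  RELEVANT states only (whether Shor's `|x⟩|g^x mod p⟩` is comparably flat is the undecided ex-crux
  `DlogGraphFlat`, stmt-QuantumAdvantage-10732);
  scope_caveats := (i) unnormalised vector, input register first (`Fin.castAdd n` input wires,
  `Fin.natAdd n` output wires), Boolean coordinates `w ↦ (if w then 1 else 0 : ZMod 2)` and back via
  `decide (· = 1)`; (ii) zero slack for even `n`; (iii) flatness `2^{1−n/2}` is within the factor `2`
  of the best possible for graph vectors of functions (`Λ ≥ 2^{n/2}` by Parseval); (iv) this is a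
  statement about ONE explicit family — it says nothing about typical circuits;
  status := theorem — MACHINE-CHECKED IN THIS TREE, Summits side:
  `Summit.QuantumAdvantage.QuantumAdvantage.Theorems.SymplecticPurity.CubeGraphFlat_proof` (files
  `Summits/QuantumAdvantage/QuantumAdvantage/Theorems/SymplecticPurityCubeGraphFlat.lean` and
  `…CubeGraphFlatField.lean`, standard axioms) closed item stmt-QuantumAdvantage-9836 of route
  `SymplecticPurity`; typed below as a NAMED FACT only because `Literature` may not import `Summits`
  (CONVENTIONS §2): the body is token for token the route decl
  `Summit.QuantumAdvantage.QuantumAdvantage.Theses.SymplecticPurity.CubeGraphFlat` (definitionally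
  equal, `Iff.rfl`, and discharged by `exact CubeGraphFlat_proof` in the filing planner's scratch
  check, 2026-08-16), so the discharge of record is the ONE-LINE Summits-side
  `theorem cubeGraphFlat_holds : Literature.Barriers.QuantumAdvantage.cubeGraphFlat :=
  Summit.QuantumAdvantage.QuantumAdvantage.Theorems.SymplecticPurity.CubeGraphFlat_proof` — do NOT
  re-prove it in `Literature`. The combination (S-box nonlinearity ⇒ flat quantum data state) was not
  located in print (route novelty audit 2026-08-15: new-combination).

## Contents

* `cubeGraphFlat` — THE BARRIER FACT of this file (the only declaration).

## Design notes

* One named fact, no other declaration (D-0026 / `lint.fact-fanout`). Written inline over `QReg`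
  (`QubitRegister.lean`) and `Pauli`, `pauliString` (`PauliExpansion.lean`) exactly as on the route,
  so that the tree theorem discharges it by `exact`; `open scoped Classical` matches the route file's
  elaboration context.

## References

* [Carlet2020] C. Carlet, *Boolean Functions for Cryptography and Coding Theory*, CUP 2021: §11.5.2
  (PDF p. 497), PDF pp. 222–223 (read). [Gold1968] R. Gold, IEEE Trans. IT 14 (1968) 154–156.
  [Nyberg1994] K. Nyberg, EUROCRYPT '93, LNCS 765, 55–64.
-/

namespace Literature.Barriers.QuantumAdvantage

open scoped BigOperators Matrix ComplexConjugate Classical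
open Literature.Computability.Cryptography Literature.Computability.QuantumComplexity

/-- **The almost-bent witness is flat.** For every field `K` with `2ⁿ` elements and every additive
identification `e : K ≃+ (Fin n → ZMod 2)`, the unnormalised graph vector `g = Σ_x |x⟩|e((e⁻¹ x)³)⟩`
on `n + n` qubits satisfies `|⟨g|σ_S|g⟩| ≤ 2·√2ⁿ` for every Pauli string `S ≠ I`; equivalently the
normalised data-loading state of the cube map is `2^{1−n/2}`-flat.
- technique_class: simulation lines needing explicit, cheaply generated arithmetic states to have a
  peaked / compressible Pauli spectrum (free Clifford or matchgate frames, Pauli truncation, low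
  stabilizer entropy)
- blocks: all of them on this family: with `symplecticPurityBound` every Clifford frame (any
  order, any stabilizer ancillas) has a bond of Schmidt rank `≥ 2^{n/2−3}`; with
  `gaussianDegreeBound` no matchgate frame compresses its initial blocks; `noFreeFrame` is the
  complexity-level consequence
- because: `graphStateSpectrum` (`≤ max(D, Λ)`) with `D = 2`, `Λ ≤ 2·√2ⁿ` for `x ↦ x³`
  [cite: Carlet2020, §11.5.2 (PDF p. 497) and PDF pp. 222–223] [cite: Gold1968] [cite: Nyberg1994]
  (`cubeAlmostBent`); additive `e` transports counts and Walsh sums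
- evasions_known: none for this family; only flatness-insensitive technique classes (non-free or
  composite frames — ex-crux `CompositeFrameBound` stmt-QuantumAdvantage-10730 undecided —
  stabilizer-rank methods) or a restriction to algorithmically relevant states (ex-crux
  `DlogGraphFlat` stmt-QuantumAdvantage-10732 undecided)
- scope_caveats: unnormalised (`‖g‖² = 2ⁿ`); input register = `Fin.castAdd`, output = `Fin.natAdd`;
  tight for even `n`; one explicit family
- status: theorem, machine-checked in this tree as
  `Summit.QuantumAdvantage.QuantumAdvantage.Theorems.SymplecticPurity.CubeGraphFlat_proof` (item
  stmt-QuantumAdvantage-9836, route `SymplecticPurity`, retired 2026-08-16); named fact here only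
  because `Literature` does not import `Summits` — body definitionally equal to the route decl,
  discharge = the one-line Summits-side `cubeGraphFlat_holds := …CubeGraphFlat_proof`
[folklore] -/
def cubeGraphFlat : Prop :=
  ∀ (n : ℕ) (K : Type) [Field K] [Fintype K], Fintype.card K = 2 ^ n → ∀ e : K ≃+ (Fin n → ZMod 2),
    ∀ S : Fin (n + n) → Pauli, S ≠ (fun _ => Pauli.I) →
      ‖star (fun w : QReg (n + n) =>
            if (fun j : Fin n => w (Fin.natAdd n j)) =
                (fun j : Fin n => decide (e ((e.symm (fun i : Fin n => if w (Fin.castAdd n i) then 1 else 0)) ^ 3) j = 1))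
            then (1 : ℂ) else 0) ⬝ᵥ
          (pauliString S).mulVec (fun w : QReg (n + n) =>
            if (fun j : Fin n => w (Fin.natAdd n j)) =
                (fun j : Fin n => decide (e ((e.symm (fun i : Fin n => if w (Fin.castAdd n i) then 1 else 0)) ^ 3) j = 1))
            then (1 : ℂ) else 0)‖ ≤ 2 * Real.sqrt 2 ^ n

end Literature.Barriers.QuantumAdvantage
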